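import Summits.HodgeConjecture.CorCM.GaloisCyclicSemidirectEightTwoSheet
import HarnessLib

/-!
# Sheets of `C_p ⋊ C₈` (and `Q₈ × C_p`) at an odd character: coordinates, expansions, the trivial block

COR-CM (cell `pub-hodgecm2`), binder seat b04 (gen 29), count-neutral claim CYCLIC-SEMIDIRECT-EIGHT-DEGENERATE, part VIIIa₁
(the field-free lemmas of the CONVERSE of part V `CorCM/GaloisCyclicSemidirectEightNormPairs`; part VIIIa₂
`…NormPairCoefficients` adds the two lemmas that use the `ℚ(i)`-independence of the `p`-th roots of unity, part VIIIb
`…NormPairConverse` is the model theorem, VIIIc `…NormPairIff` the dichotomy criterion).  KERNEL ONLY: theorems; no definition,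
no named fact, no `sorry`.  `HC_CM` is neither used nor claimed.

An odd character of `A = ℤ/4 × ℤ/p` is `χ = ψ_α ⊗ ψ_β` with `α = χ(1,0) = ±i` and `β = χ(0,1)`, `β^p = 1` (§2); a CM set read
on `C_p ⋊ C₈` or `Q₈ × C_p` has two SHEETS `k₀, k₁ : ℤ/p → ℤ/4` (§1 `sheet_of_cm`: a subset of `ℤ/4` meeting each pair `{t, t+2}`
once is `{k, k+1}`), with sheet sums `(1 + α)·Gⱼ(β)`, `Gⱼ(β) = Σ_v α^{kⱼ(v)} β^v`.  Writing `α^k = a(k) + b(k)·α` with the INTEGER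
coordinates `a = [k=0] − [k=2]`, `b = [k=1] − [k=3]` (§1 `psi_eq_coord`, `eq_of_coord_eq`, `coord_add_coord_odd`, `coord_neg`):
* §3 `sheet_mul_sheet`: `G(β)G(β⁻¹) = Σ_d (Σ_v α^{k(v)+k(v−d)}) β^d` (part V's expansion, any `ψ_α, ψ_β`); `sheet_mul_sheet_tau`:
  `G(β)G^τ(β) = Σ_d (Σ_v α^{k(v)−k(d−v)}) β^d` (the `Q₈ × C_p` form); `sum_psi_eq_coord` (a coefficient is `A + Bα`, `A, B ∈ ℤ`);
* §3 **`sum_psi_sq_ne`** — the block of the character TRIVIAL on `ℤ/p` is never singular: `G₀(1)² ≠ α G₁(1)²`, since comparing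
  `α`-parts gives `2A₀B₀ = A₁² − B₁²` with `A₁ + B₁ ≡ p ≡ 1 (mod 2)`.

## References

* [Kubota1965] T. Kubota, *On the field extension by complex multiplication*, Trans. AMS 118 (1965), §4 Lemma 2.
-/

noncomputable section

open scoped BigOperators

namespace Summit.HodgeConjecture.CorCM.GaloisCyclicSemidirectEight

open Literature.NumberTheory.ComplexMultiplication (IsCMTypeWith)
open Summit.HodgeConjecture.CorCM.GaloisQuaternionCyclic (omega_mul_omega)
open AddChar
open Multiplicative (ofAdd toAdd)

/-! ## §1 Bookkeeping: CM subsets of `ℤ/4`, `α = ±i`, the coordinates of `ψ_α` -/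

/-- A subset of `ℤ/4` containing exactly one of `t, t + 2` for every `t` is `{k, k + 1}` for some `k`. [folklore] -/
theorem sheet_of_cm (P : ZMod (2 * 2) → Prop) (hP : ∀ t, P (t + 2) ↔ ¬ P t) :
    ∃ k : ZMod (2 * 2), ∀ t, P t ↔ (t = k ∨ t = k + 1) := by
  classical
  have ht : ∀ t : ZMod (2 * 2), t = 0 ∨ t = 1 ∨ t = 0 + 2 ∨ t = 1 + 2 := by decide
  by_cases h0 : P 0 <;> by_cases h1 : P 1 <;>
    [refine ⟨0, ?_⟩; refine ⟨3, ?_⟩; refine ⟨1, ?_⟩; refine ⟨2, ?_⟩] <;>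
    intro t <;> rcases ht t with rfl | rfl | rfl | rfl <;>
    simp only [hP, h0, h1, true_iff, false_iff, not_true_eq_false, not_false_eq_true] <;> decide

/-- `α² = −1` in `ℂ` forces `α = ε·i` with `ε = ±1`. [folklore] -/
theorem exists_sign_of_mul_self_eq_neg_one {α : ℂ} (h : α * α = -1) :
    ∃ ε : ℤ, (ε = 1 ∨ ε = -1) ∧ α = ε * Complex.I := by
  have h' : (α - Complex.I) * (α + Complex.I) = 0 := by linear_combination h - Complex.I_sq
  rcases mul_eq_zero.1 h' with h1 | h1
  · exact ⟨1, Or.inl rfl, by push_cast; linear_combination h1⟩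
  · exact ⟨-1, Or.inr rfl, by push_cast; linear_combination h1⟩

/-- `α = ±i` satisfies `α² = −1`. [folklore] -/
theorem alpha_mul_self {α : ℂ} {ε : ℤ} (hε : ε = 1 ∨ ε = -1) (hα : α = ε * Complex.I) : α * α = -1 := by
  rw [hα]; rcases hε with rfl | rfl <;> push_cast <;> linear_combination Complex.I_sq

/-- `α = ±i` satisfies `α^(2·2) = 1`. [folklore] -/
theorem alpha_pow_four {α : ℂ} {ε : ℤ} (hε : ε = 1 ∨ ε = -1) (hα : α = ε * Complex.I) : α ^ (2 * 2) = 1 := by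
  rcases hε with rfl | rfl
  · rw [hα]; push_cast; rw [one_mul, Complex.I_pow_four]
  · rw [hα]; push_cast; rw [mul_pow, Complex.I_pow_four]; norm_num

/-- `u + v·α = 0` with `u, v ∈ ℤ` and `α = ±i` forces `u = v = 0`. [folklore] -/
theorem eq_zero_of_int_add_int_mul_alpha {α : ℂ} {ε : ℤ} (hε : ε = 1 ∨ ε = -1) (hα : α = ε * Complex.I) {u v : ℤ}
    (h : (u : ℂ) + (v : ℂ) * α = 0) : u = 0 ∧ v = 0 := by
  rw [hα, Complex.ext_iff] at h
  obtain ⟨hre, him⟩ := h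
  simp only [Complex.add_re, Complex.intCast_re, Complex.mul_re, Complex.intCast_im, Complex.mul_im, Complex.I_re,
    Complex.I_im, Complex.add_im, Complex.zero_re, Complex.zero_im, mul_zero, mul_one, zero_mul, sub_zero, add_zero,
    zero_add] at hre him
  refine ⟨by exact_mod_cast hre, ?_⟩
  have hv : (v : ℝ) * ε = 0 := by linarith
  rcases hε with rfl | rfl
  · simpa using hv
  · simpa using hv

/-- **Coordinates of `ψ_α`.**  For `α^(2·2) = 1`, `α² = −1`: `ψ_α(k) = α^k = a(k) + b(k)·α` with the INTEGERS
`a(k) = [k = 0] − [k = 2]`, `b(k) = [k = 1] − [k = 3]`. [folklore] -/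
theorem psi_eq_coord {α : ℂ} (hα4 : α ^ (2 * 2) = 1) (hαα : α * α = -1) (k : ZMod (2 * 2)) :
    zmodChar (2 * 2) hα4 k = (((if k = 0 then 1 else 0) - (if k = 2 then 1 else 0) : ℤ) : ℂ) +
      (((if k = 1 then 1 else 0) - (if k = 3 then 1 else 0) : ℤ) : ℂ) * α := by
  have h10 : (1 : ZMod (2 * 2)) ≠ 0 := by decide
  have h12 : (1 : ZMod (2 * 2)) ≠ 2 := by decide
  have h13 : (1 : ZMod (2 * 2)) ≠ 3 := by decide
  have h20 : (2 : ZMod (2 * 2)) ≠ 0 := by decide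
  have h21 : (2 : ZMod (2 * 2)) ≠ 1 := by decide
  have h23 : (2 : ZMod (2 * 2)) ≠ 3 := by decide
  have h30 : (3 : ZMod (2 * 2)) ≠ 0 := by decide
  have h31 : (3 : ZMod (2 * 2)) ≠ 1 := by decide
  have h32 : (3 : ZMod (2 * 2)) ≠ 2 := by decide
  have h02 : (0 : ZMod (2 * 2)) ≠ 2 := by decide
  have h01 : (0 : ZMod (2 * 2)) ≠ 1 := by decide
  have h03 : (0 : ZMod (2 * 2)) ≠ 3 := by decide
  have hk : k = 0 ∨ k = 1 ∨ k = 2 ∨ k = 3 := by revert k; decide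
  rcases hk with rfl | rfl | rfl | rfl <;> rw [zmodChar_apply]
  · rw [ZMod.val_zero, pow_zero]
    simp only [if_true, h02, h01, h03, if_false]; push_cast; ring
  · rw [show (1 : ZMod (2 * 2)).val = 1 from rfl, pow_one]
    simp only [if_true, h10, h12, h13, if_false]; push_cast; ring
  · rw [show (2 : ZMod (2 * 2)).val = 2 from rfl, pow_two, hαα]
    simp only [if_true, h20, h21, h23, if_false]; push_cast; ring
  · rw [show (3 : ZMod (2 * 2)).val = 3 from rfl, pow_succ, pow_two, hαα]
    simp only [if_true, h30, h31, h32, if_false]; push_cast; ring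

/-- The coordinates `(a(k), b(k))` determine `k`. [folklore] -/
theorem eq_of_coord_eq (k k' : ZMod (2 * 2))
    (ha : ((if k = 0 then 1 else 0) - (if k = 2 then 1 else 0) : ℤ) = (if k' = 0 then 1 else 0) - (if k' = 2 then 1 else 0))
    (hb : ((if k = 1 then 1 else 0) - (if k = 3 then 1 else 0) : ℤ) = (if k' = 1 then 1 else 0) - (if k' = 3 then 1 else 0)) :
    k = k' := by
  revert k k' ha hb
  decide

/-- `a(k) + b(k)` is odd (it is `±1`). [folklore] -/
theorem coord_add_coord_odd (k : ZMod (2 * 2)) :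
    (((if k = 0 then 1 else 0) - (if k = 2 then 1 else 0) + ((if k = 1 then 1 else 0) - (if k = 3 then 1 else 0)) : ℤ) :
      ZMod 2) = 1 := by
  revert k
  decide

/-! ## §2 The character `χ = ψ_α ⊗ ψ_β` -/

section Character

variable {p : ℕ} [Fact p.Prime]
variable (χ : AddChar (Additive (Multiplicative (ZMod (2 * 2)) × Multiplicative (ZMod p))) ℂ)

/-- `χ(t, x) = α^t · β^x` with `α = χ(1, 0)`, `β = χ(0, 1)`. [folklore] -/
theorem character_eq_mul_pow (t : Multiplicative (ZMod (2 * 2))) (x : Multiplicative (ZMod p)) :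
    χ (Additive.ofMul (t, x)) =
      χ (Additive.ofMul (ofAdd (1 : ZMod (2 * 2)), (1 : Multiplicative (ZMod p)))) ^ (toAdd t).val *
        χ (Additive.ofMul ((1 : Multiplicative (ZMod (2 * 2))), ofAdd (1 : ZMod p))) ^ (toAdd x).val := by
  have hp : p.Prime := Fact.out
  haveI : NeZero p := ⟨hp.ne_zero⟩
  have ht : t = ofAdd (1 : ZMod (2 * 2)) ^ (toAdd t).val := by
    rw [← ofAdd_nsmul, nsmul_eq_mul, mul_one, ZMod.natCast_zmod_val, ofAdd_toAdd]
  have hx : x = ofAdd (1 : ZMod p) ^ (toAdd x).val := by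
    rw [← ofAdd_nsmul, nsmul_eq_mul, mul_one, ZMod.natCast_zmod_val, ofAdd_toAdd]
  conv_lhs => rw [show (t, x) = (t, (1 : Multiplicative (ZMod p))) * ((1 : Multiplicative (ZMod (2 * 2))), x) by
    rw [Prod.mk_mul_mk, mul_one, one_mul]]
  rw [ofMul_mul, map_add_eq_mul]
  congr 1
  · conv_lhs => rw [ht]
    rw [← map_nsmul_eq_pow, ← ofMul_pow, Prod.pow_mk, one_pow]
  · conv_lhs => rw [hx]
    rw [← map_nsmul_eq_pow, ← ofMul_pow, Prod.pow_mk, one_pow]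

/-- `β^p = 1` for `β = χ(0, 1)`. [folklore] -/
theorem character_snd_pow_eq_one :
    χ (Additive.ofMul ((1 : Multiplicative (ZMod (2 * 2))), ofAdd (1 : ZMod p))) ^ p = 1 := by
  rw [← map_nsmul_eq_pow, ← ofMul_pow, Prod.pow_mk, one_pow, ← ofAdd_nsmul, nsmul_eq_mul, mul_one,
    ZMod.natCast_self, ofAdd_zero, ← Prod.one_eq_mk, ofMul_one, map_zero_eq_one]

/-- `α^(2·2) = 1` for `α = χ(1, 0)`. [folklore] -/
theorem character_fst_pow_eq_one :
    χ (Additive.ofMul (ofAdd (1 : ZMod (2 * 2)), (1 : Multiplicative (ZMod p)))) ^ (2 * 2) = 1 := by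
  rw [← map_nsmul_eq_pow, ← ofMul_pow, Prod.pow_mk, one_pow, ← ofAdd_nsmul, nsmul_eq_mul, mul_one,
    show ((2 * 2 : ℕ) : ZMod (2 * 2)) = 0 from rfl, ofAdd_zero, ← Prod.one_eq_mk, ofMul_one, map_zero_eq_one]

end Character

/-! ## §3 Sheet sums: the coefficient expansion, the trivial character, the norm pair, constancy -/

section Sheets

variable {p : ℕ} [Fact p.Prime]

/-- **Coefficient expansion**: `(Σ_v ψ_α(k v) ψ_β(v)) (Σ_v ψ_α(k v) ψ_β(−v)) = Σ_d (Σ_v ψ_α(k v + k(v − d))) ψ_β(d)`.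
[cite: Kubota1965, §4 Lemma 2] -/
theorem sheet_mul_sheet (ψ4 : AddChar (ZMod (2 * 2)) ℂ) (ψp : AddChar (ZMod p) ℂ) (k : ZMod p → ZMod (2 * 2)) :
    (∑ v : ZMod p, ψ4 (k v) * ψp v) * (∑ v : ZMod p, ψ4 (k v) * ψp (-v)) =
      ∑ d : ZMod p, (∑ v : ZMod p, ψ4 (k v + k (v - d))) * ψp d := by
  rw [Finset.sum_mul_sum]
  have e1 : ∀ v : ZMod p, ∑ w : ZMod p, ψ4 (k v) * ψp v * (ψ4 (k w) * ψp (-w)) =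
      ∑ d : ZMod p, ψ4 (k v + k (v - d)) * ψp d := fun v => by
    refine Fintype.sum_equiv (Equiv.subLeft v) _ _ fun w => ?_
    simp only [Equiv.subLeft_apply, sub_sub_cancel, map_add_eq_mul]
    rw [show ψp (v - w) = ψp v * ψp (-w) by rw [sub_eq_add_neg, map_add_eq_mul]]
    ring
  simp_rw [e1]
  rw [Finset.sum_comm]
  refine Finset.sum_congr rfl fun d _ => ?_
  rw [Finset.sum_mul]

/-- **Twisted coefficient expansion**: `(Σ_v ψ_α(k v) ψ_β(v)) (Σ_v ψ_α(−k v) ψ_β(v)) = Σ_d (Σ_v ψ_α(k v − k(d − v))) ψ_β(d)`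
(`θ` inverts the `ℤ/4`-factor and fixes `ℤ/p`). [cite: Kubota1965, §4 Lemma 2] -/
theorem sheet_mul_sheet_tau (ψ4 : AddChar (ZMod (2 * 2)) ℂ) (ψp : AddChar (ZMod p) ℂ) (k : ZMod p → ZMod (2 * 2)) :
    (∑ v : ZMod p, ψ4 (k v) * ψp v) * (∑ v : ZMod p, ψ4 (-k v) * ψp v) =
      ∑ d : ZMod p, (∑ v : ZMod p, ψ4 (k v - k (d - v))) * ψp d := by
  rw [Finset.sum_mul_sum]
  have e1 : ∀ v : ZMod p, ∑ w : ZMod p, ψ4 (k v) * ψp v * (ψ4 (-k w) * ψp w) =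
      ∑ d : ZMod p, ψ4 (k v - k (d - v)) * ψp d := fun v => by
    refine (Fintype.sum_equiv (Equiv.subRight v) _ _ fun d => ?_).symm
    simp only [Equiv.subRight_apply]
    rw [show ψp (d - v) = ψp d * ψp (-v) by rw [sub_eq_add_neg, map_add_eq_mul],
      show ψ4 (k v - k (d - v)) = ψ4 (k v) * ψ4 (-k (d - v)) by rw [sub_eq_add_neg, map_add_eq_mul]]
    have hvv : ψp v * ψp (-v) = 1 := by rw [← map_add_eq_mul, add_neg_cancel, map_zero_eq_one]
    linear_combination (-(ψ4 (k v) * ψ4 (-k (d - v)) * ψp d)) * hvv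
  simp_rw [e1]
  rw [Finset.sum_comm]
  refine Finset.sum_congr rfl fun d _ => ?_
  rw [Finset.sum_mul]

/-- Coordinates of `ψ_α(−k)`: `a(−k) = a(k)`, `b(−k) = −b(k)`. [folklore] -/
theorem coord_neg (k : ZMod (2 * 2)) :
    ((if -k = 0 then 1 else 0) - (if -k = 2 then 1 else 0) : ℤ) = (if k = 0 then 1 else 0) - (if k = 2 then 1 else 0) ∧
    ((if -k = 1 then 1 else 0) - (if -k = 3 then 1 else 0) : ℤ) = -((if k = 1 then 1 else 0) - (if k = 3 then 1 else 0)) := by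
  revert k; decide

/-- The coefficient `Σ_v ψ_α(s v)` in coordinates: `A + B·α` with the integers `A = Σ_v a(s v)`, `B = Σ_v b(s v)`.
[folklore] -/
theorem sum_psi_eq_coord {α : ℂ} (hα4 : α ^ (2 * 2) = 1) (hαα : α * α = -1) (s : ZMod p → ZMod (2 * 2)) :
    ∑ v : ZMod p, zmodChar (2 * 2) hα4 (s v) =
      ((∑ v : ZMod p, ((if s v = 0 then 1 else 0) - (if s v = 2 then 1 else 0) : ℤ) : ℤ) : ℂ) +
        ((∑ v : ZMod p, ((if s v = 1 then 1 else 0) - (if s v = 3 then 1 else 0) : ℤ) : ℤ) : ℂ) * α := by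
  simp_rw [psi_eq_coord hα4 hαα]
  push_cast
  rw [Finset.sum_add_distrib, Finset.sum_mul]

/-- **The block of the character trivial on `ℤ/p` is never singular**: `(Σ_v ψ_α(k₀ v))² ≠ α (Σ_v ψ_α(k₁ v))²` —
`Σ_v ψ_α(kⱼ v) = Aⱼ + Bⱼ α` with `Aⱼ + Bⱼ ≡ p ≡ 1 (mod 2)`, and comparing `α`-parts gives `2A₀B₀ = A₁² − B₁²`, odd.
[cite: Kubota1965, §4 Lemma 2] -/
theorem sum_psi_sq_ne (hp2 : p ≠ 2) {α : ℂ} {ε : ℤ} (hε : ε = 1 ∨ ε = -1) (hα : α = ε * Complex.I)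
    (k₀ k₁ : ZMod p → ZMod (2 * 2)) :
    (∑ v : ZMod p, zmodChar (2 * 2) (alpha_pow_four hε hα) (k₀ v)) *
        (∑ v : ZMod p, zmodChar (2 * 2) (alpha_pow_four hε hα) (k₀ v)) -
      α * ((∑ v : ZMod p, zmodChar (2 * 2) (alpha_pow_four hε hα) (k₁ v)) *
        (∑ v : ZMod p, zmodChar (2 * 2) (alpha_pow_four hε hα) (k₁ v))) ≠ 0 := by
  have hp : p.Prime := Fact.out
  have hαα : α * α = -1 := alpha_mul_self hε hα
  rw [sum_psi_eq_coord _ hαα k₀, sum_psi_eq_coord _ hαα k₁]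
  set A₀ : ℤ := ∑ v : ZMod p, ((if k₀ v = 0 then 1 else 0) - (if k₀ v = 2 then 1 else 0) : ℤ)
  set B₀ : ℤ := ∑ v : ZMod p, ((if k₀ v = 1 then 1 else 0) - (if k₀ v = 3 then 1 else 0) : ℤ)
  set A₁ : ℤ := ∑ v : ZMod p, ((if k₁ v = 0 then 1 else 0) - (if k₁ v = 2 then 1 else 0) : ℤ)
  set B₁ : ℤ := ∑ v : ZMod p, ((if k₁ v = 1 then 1 else 0) - (if k₁ v = 3 then 1 else 0) : ℤ)
  -- parity: `A₁ + B₁ ≡ p ≡ 1 (mod 2)`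
  have hodd : ((A₁ + B₁ : ℤ) : ZMod 2) = 1 := by
    have h1 : ((A₁ + B₁ : ℤ) : ZMod 2) = ∑ v : ZMod p, (1 : ZMod 2) := by
      rw [← Finset.sum_add_distrib, Int.cast_sum]
      exact Finset.sum_congr rfl fun v _ => coord_add_coord_odd (k₁ v)
    rw [h1, Finset.sum_const, Finset.card_univ, ZMod.card, nsmul_eq_mul, mul_one]
    have hodd : Odd p := hp.odd_of_ne_two hp2
    rw [ZMod.natCast_eq_one_iff_odd]
    exact hodd
  intro h
  -- `(A₀ + B₀α)² − α (A₁ + B₁α)² = (A₀² − B₀² + 2A₁B₁) + (2A₀B₀ − A₁² + B₁²) α`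
  have h' : ((A₀ ^ 2 - B₀ ^ 2 + 2 * A₁ * B₁ : ℤ) : ℂ) + ((2 * A₀ * B₀ - A₁ ^ 2 + B₁ ^ 2 : ℤ) : ℂ) * α = 0 := by
    push_cast
    linear_combination h + (-(B₀ : ℂ) ^ 2 + 2 * (A₁ : ℂ) * B₁ + (B₁ : ℂ) ^ 2 * α) * hαα
  obtain ⟨-, h2⟩ := eq_zero_of_int_add_int_mul_alpha hε hα h'
  -- mod 2: `A₁² − B₁² ≡ (A₁ + B₁)² ≡ 1`, `2A₀B₀ ≡ 0`
  have h3 := congrArg (fun z : ℤ => (z : ZMod 2)) h2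
  simp only [Int.cast_sub, Int.cast_add, Int.cast_mul, Int.cast_pow, Int.cast_ofNat, Int.cast_zero] at h3
  have h4 : ((A₁ : ℤ) : ZMod 2) = 1 - (B₁ : ZMod 2) := by
    rw [Int.cast_add] at hodd; linear_combination hodd
  rw [h4] at h3
  have h5 : ∀ a₀ b₀ b : ZMod 2, (2 : ZMod 2) * a₀ * b₀ - (1 - b) ^ 2 + b ^ 2 ≠ 0 := by decide
  exact h5 _ _ _ h3

end Sheets

end Summit.HodgeConjecture.CorCM.GaloisCyclicSemidirectEight

end
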